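import Mathlib.Analysis.InnerProductSpace.Projection.Basic
import Mathlib.Analysis.InnerProductSpace.Symmetric
import Mathlib.Analysis.InnerProductSpace.Calculus
import Mathlib.Analysis.Calculus.MeanValue
import HarnessLib

/-!
# The time-dependent variational principle: projector (Dirac–Frenkel / McLachlan) form

Topic `Literature/MathematicalPhysics/QuantumManyBody`.  The **time-dependent variational
principle** (TDVP) replaces the Schrödinger velocity `−iĤψ` of a state `ψ` on a variational
manifold by its best approximation inside the tangent space: "Insertion into the time-dependent
Schrödinger equation results in `Ȧⁱ |∂ᵢψ(A(t))⟩ = −i Ĥ|ψ(A(t))⟩` … Whereas the left hand side is a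
linear combination of the tangent vectors `|∂ᵢψ⟩` that span the tangent plane, the right hand
side is a general vector in Hilbert space and this equation does not have an exact solution for
`Ȧⁱ`.  The best approximation is obtained by minimizing `‖Ȧⁱ|∂ᵢψ⟩ + iĤ|ψ⟩‖`.  The minimum is found
by orthogonally projecting the evolution vector onto the tangent plane.  The resulting solution is
determined by `⟨∂_ȷ̄ψ|∂ᵢψ⟩ Ȧⁱ = −i⟨∂_ȷ̄ψ|Ĥ|ψ⟩` (2) … the Gram matrix of the tangent vectors
`G_{ı̄j} = ⟨∂_ı̄ψ|∂ⱼψ⟩`" [cite: HaegemanEtAl2011, p. 3 and Eq. (2)]; in the geometric language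
of Hackl–Guaita–Shi–Haegeman–Demler–Cirac, the **McLachlan minimal error principle** "we can
quantify the local error in state norm `‖(d/dt)|ψ⟩ − (−iĤ)|ψ⟩‖` … It is minimized by the projection
`ℚ_ψ (d/dt)|ψ⟩ = −ℙ_ψ iĤ|ψ⟩`", the **Dirac–Frenkel principle** "`⟨δψ|(i d/dt − Ĥ)|ψ⟩ = 0` for all
allowed variations `|δψ⟩`", and the **Lagrangian** form `ℙ_ψ(i d/dt − Ĥ)|ψ⟩ = 0`, which "only differ
by a factor of `i`" and coincide exactly when "multiplication by `i` commutes with the projector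
`ℙ_ψ`", i.e. when the tangent space is a complex subspace (Kähler case)
[cite: HacklEtAl2020, §4.1.1 and Prop. 6 (with its proof)].

This file formalizes the principle at one instant, for a tangent space that is a **complex-linear
subspace** `K` of a complex inner-product space `E` admitting an orthogonal projection
(`K.HasOrthogonalProjection`; every finite-dimensional or complete `K`) — the setting of MPS/TTN/
neural-state tangent planes with complex parameters (Haegeman et al.; Hackl et al.'s Kähler case)
— and a bounded Hamiltonian `H : E →L[ℂ] E` (all lattice models on finitely many sites):

* `tdvpVelocity K H ψ = P_K(−i Hψ)` — the TDVP/McLachlan velocity [cite: HacklEtAl2020, §4.1.1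
  ("It is minimized by the projection `ℚ_ψ (d/dt)ψ = −ℙ_ψ iĤψ`")];
* **least squares** (`norm_sq_add_eq`, `norm_tdvpVelocity_add_le`, `norm_tdvpVelocity_add_eq_iInf`,
  `eq_tdvpVelocity_of_norm_le`): for every tangent vector `v ∈ K`,
  `‖v + iHψ‖² = ‖v − P_K(−iHψ)‖² + ‖P_K(−iHψ) + iHψ‖²`, so `P_K(−iHψ)` is the unique minimiser of
  Haegeman et al.'s `‖Ȧⁱ|∂ᵢψ⟩ + iĤ|ψ⟩‖` / McLachlan's local error [cite: HaegemanEtAl2011, p. 3]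
  [cite: HacklEtAl2020, §4.1.1];
* **Dirac–Frenkel / Galerkin orthogonality** (`inner_tdvpVelocity_of_mem`, `diracFrenkel`,
  `eq_tdvpVelocity_of_forall_inner_eq`): `⟨v|ψ̇⟩ = −i⟨v|Ĥ|ψ⟩`, equivalently
  `⟨v|(i d/dt − Ĥ)ψ⟩ = 0`, for all `v ∈ K`, and this characterises `ψ̇ ∈ K`
  [cite: HacklEtAl2020, §4.1.1 (Dirac–Frenkel)];
* **the Gram (normal) equations** (`gram_eq`, `sum_smul_eq_tdvpVelocity_of_gram`): for a
  finite family of tangent vectors `b i` spanning `K` and `ψ̇ = Σᵢ aᵢ bᵢ`,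
  `Σᵢ ⟨b_j|b_i⟩ aᵢ = −i⟨b_j|Ĥ|ψ⟩` for every `j`, and conversely any solution `a` of these equations
  assembles to `ψ̇` [cite: HaegemanEtAl2011, Eq. (2)];
* the **Lagrangian and McLachlan projected equations coincide** for complex `K`
  (`mcLachlan_projected`, `lagrangian_projected`: `P_K(ψ̇ + iHψ) = 0` and `P_K(iψ̇ − Hψ) = 0`)
  [cite: HacklEtAl2020, Prop. 6 (proof: "`ℙ_ψ(i d/dt − Ĥ)|ψ⟩ = 0`", "`ℙ_ψ(d/dt + iĤ)|ψ⟩ = 0`")];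
* **conservation laws** — norm/phase: if the tangent space contains the state (`ψ ∈ K`, "the
  tangent plane contains the state itself" [cite: HaegemanEtAl2011, p. 3]) then `Re⟨ψ|ψ̇⟩ = 0`
  (`re_inner_self_tdvpVelocity`); energy: `Re⟨Ĥψ|ψ̇⟩ = 0` on ANY complex tangent space, and
  `⟨ψ̇|Ĥψ⟩ + ⟨ψ|Ĥψ̇⟩ = 0` for symmetric `Ĥ` (`re_inner_hamiltonian_tdvpVelocity`,
  `inner_tdvpVelocity_hamiltonian_add`) — "they respect energy conservation as well as conservation
  of all constants of motion, such as the expectation value of generators of symmetries"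
  [cite: HaegemanEtAl2011, p. 3], "energy expectation value is conserved if the Hamiltonian is
  time-independent" [cite: HacklEtAl2020, §2.2.2]; symmetry generators: for symmetric `Â` commuting
  with `Ĥ` on `ψ` and preserving the manifold in Hackl et al.'s sense `(Â − ⟨Â⟩)ψ ∈ K`,
  `Re⟨Âψ|ψ̇⟩ = ⟨Â⟩·Re⟨ψ|ψ̇⟩` (`re_inner_symm_tdvpVelocity`), whence the quotient-rule numerator of
  `d/dt (⟨ψ|Â|ψ⟩/⟨ψ|ψ⟩)` vanishes (`expectation_numerator_eq_zero`) [cite: HacklEtAl2020, Prop. 7];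
* **along a trajectory** (`HasDerivAt` packaging of the above with the product rule for `⟨·|·⟩`):
  if `γ : ℝ → E` has velocity `tdvpVelocity (Kt t) H (γ t)` at every `t` for some family of
  complex tangent spaces `Kt t`, then `t ↦ Re⟨γ t|Ĥ|γ t⟩` is constant (`energy_conserved`),
  `t ↦ ‖γ t‖²` is constant when `γ t ∈ Kt t` (`norm_sq_conserved`), and `t ↦ Re⟨γ t|Â|γ t⟩` is
  constant under the hypotheses of Prop. 7 with `γ t ∈ Kt t` (`expectation_conserved`)
  [cite: HacklEtAl2020, §2.2.2, Prop. 7] [cite: HaegemanEtAl2011, p. 3].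

Not covered (scope caveats): real-linear (non-Kähler) tangent spaces, where the three principles
differ and McLachlan evolution need not conserve energy [cite: HacklEtAl2020, §3.4, Prop. 6];
unbounded Hamiltonians; the symplectic/Poisson structure of the flow; error bounds over time.

(pub-qadeq lane context: CLAIMS.md rows E-18 (time-dependent VMC), E-21/E-37/E-50 (TDVP-MPS /
tensor-network real-time challengers to analog and digital quantum-simulation advantage claims) all
integrate exactly these projected equations; this file is the tree vocabulary for "what a TDVP
engine solves at each step" and for the two invariants (norm, energy) such engines report.  HONEST
FRAMING: instance-level adjudication of specific advantage claims; no claim about BQP vs BPP or the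
summit — this file is Hilbert-space geometry and says nothing about any experiment or runtime.)

## References

* J. Haegeman, J. I. Cirac, T. J. Osborne, I. Pižorn, H. Verschelde, F. Verstraete, *Time-dependent
  variational principle for quantum lattices*, Phys. Rev. Lett. **107**, 070601 (2011),
  arXiv:1103.0936 — p. 3, Eq. (2).  [HaegemanEtAl2011]
* L. Hackl, T. Guaita, T. Shi, J. Haegeman, E. Demler, J. I. Cirac, *Geometry of variational
  methods: dynamics of closed quantum systems*, SciPost Phys. **9**, 048 (2020), arXiv:2004.01015 —
  §2.2.2, §4.1.1 (Lagrangian / McLachlan / Dirac–Frenkel), Props. 6, 7 (numbering of the arXiv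
  text).  [HacklEtAl2020]
* Mathlib: `Submodule.starProjection` and its characterisation
  (`Submodule.starProjection_inner_eq_zero`, `Submodule.eq_starProjection_of_mem_of_inner_eq_zero`,
  `Submodule.starProjection_minimal`), `LinearMap.IsSymmetric`, `HasDerivAt.inner`.
-/

namespace Literature.MathematicalPhysics.QuantumManyBody.TimeDependentVariationalPrinciple

open Complex ComplexConjugate
open scoped InnerProductSpace

variable {E : Type*} [NormedAddCommGroup E] [InnerProductSpace ℂ E]
variable (K : Submodule ℂ E) [K.HasOrthogonalProjection]

/-! ### The projected velocity -/

/-- The **TDVP (McLachlan / Dirac–Frenkel) velocity** of the state `ψ` under the Hamiltonian `H`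
on the complex tangent space `K`: the orthogonal projection of the Schrödinger velocity `−i Hψ`
onto `K`, "`ℚ_ψ (d/dt)|ψ⟩ = −ℙ_ψ iĤ|ψ⟩`". [cite: HacklEtAl2020, §4.1.1 (McLachlan minimal error principle)]
[cite: HaegemanEtAl2011, p. 3 ("orthogonally projecting the evolution vector onto the tangent plane")] -/
noncomputable def tdvpVelocity (H : E →L[ℂ] E) (ψ : E) : E := K.starProjection ((-I) • H ψ)

variable (H : E →L[ℂ] E) (ψ : E)

/-- Unfolding. [cite: HacklEtAl2020, §4.1.1] -/
theorem tdvpVelocity_def : tdvpVelocity K H ψ = K.starProjection ((-I) • H ψ) := rfl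

/-- The projected velocity is a tangent vector. [cite: HacklEtAl2020, §4.1.1] -/
theorem tdvpVelocity_mem : tdvpVelocity K H ψ ∈ K := K.starProjection_apply_mem _

/-- Complex-linearity of the projector (the Kähler property of a complex tangent space:
"multiplication by `i` commutes with the projector `ℙ_ψ`"): `P_K(−iHψ) = −i P_K(Hψ)`.
[cite: HacklEtAl2020, Prop. 6 (proof)] -/
theorem tdvpVelocity_eq_smul : tdvpVelocity K H ψ = (-I) • K.starProjection (H ψ) := by
  rw [tdvpVelocity_def, map_smul]

/-! ### Dirac–Frenkel / Galerkin orthogonality -/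

/-- **Galerkin condition**: against every tangent vector `v ∈ K` the projected velocity has the
same matrix element as the exact one, `⟨v|ψ̇⟩ = −i⟨v|Ĥ|ψ⟩` (Haegeman et al.'s Eq. (2) tested on a
single tangent vector). [cite: HaegemanEtAl2011, Eq. (2)] [cite: HacklEtAl2020, §4.1.1] -/
theorem inner_tdvpVelocity_of_mem {v : E} (hv : v ∈ K) :
    ⟪v, tdvpVelocity K H ψ⟫_ℂ = -I * ⟪v, H ψ⟫_ℂ := by
  rw [tdvpVelocity_def, ← Submodule.inner_starProjection_left_eq_right,
    Submodule.starProjection_eq_self_iff.mpr hv, inner_smul_right]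

/-- The residual `ψ̇ + iĤψ` is orthogonal to the tangent space. [cite: HacklEtAl2020, §4.1.1] -/
theorem inner_tdvpVelocity_add_eq_zero {v : E} (hv : v ∈ K) :
    ⟪v, tdvpVelocity K H ψ + I • H ψ⟫_ℂ = 0 := by
  rw [inner_add_right, inner_tdvpVelocity_of_mem K H ψ hv, inner_smul_right]
  ring

/-- **Dirac–Frenkel variational principle** "`⟨δψ|(i d/dt − Ĥ)|ψ⟩ = 0` for all allowed variations":
with `(d/dt)ψ = tdvpVelocity K H ψ` it holds for every `δψ ∈ K`. [cite: HacklEtAl2020, §4.1.1 (Dirac–Frenkel)] -/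
theorem diracFrenkel {v : E} (hv : v ∈ K) :
    ⟪v, I • tdvpVelocity K H ψ - H ψ⟫_ℂ = 0 := by
  rw [inner_sub_right, inner_smul_right, inner_tdvpVelocity_of_mem K H ψ hv, ← mul_assoc,
    mul_neg, Complex.I_mul_I]
  ring

/-- **Uniqueness**: a tangent vector satisfying the Galerkin/Dirac–Frenkel conditions against all of
`K` IS the projected velocity (the orthogonal projection is the unique point of `K` with the
orthogonality property). [cite: HacklEtAl2020, §4.1.1] [cite: HaegemanEtAl2011, Eq. (2)] -/
theorem eq_tdvpVelocity_of_forall_inner_eq {w : E} (hw : w ∈ K)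
    (h : ∀ v ∈ K, ⟪v, w⟫_ℂ = -I * ⟪v, H ψ⟫_ℂ) : w = tdvpVelocity K H ψ := by
  rw [tdvpVelocity_def]
  refine (Submodule.eq_starProjection_of_mem_of_inner_eq_zero hw fun v hv => ?_).symm
  rw [← inner_conj_symm, inner_sub_right, h v hv, inner_smul_right, sub_self, map_zero]

/-! ### Least squares (McLachlan's minimal error; Haegeman et al.'s `‖Ȧⁱ|∂ᵢψ⟩ + iĤ|ψ⟩‖`) -/

/-- **Pythagoras for the local error**: for every tangent vector `v ∈ K`,
`‖v + iHψ‖² = ‖v − ψ̇‖² + ‖ψ̇ + iHψ‖²` with `ψ̇ = tdvpVelocity K H ψ`.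
[cite: HacklEtAl2020, §4.1.1 (McLachlan)] [cite: HaegemanEtAl2011, p. 3] -/
theorem norm_sq_add_eq {v : E} (hv : v ∈ K) :
    ‖v + I • H ψ‖ ^ 2 = ‖v - tdvpVelocity K H ψ‖ ^ 2 + ‖tdvpVelocity K H ψ + I • H ψ‖ ^ 2 := by
  have hsplit : v + I • H ψ = (v - tdvpVelocity K H ψ) + (tdvpVelocity K H ψ + I • H ψ) := by abel
  have horth : ⟪v - tdvpVelocity K H ψ, tdvpVelocity K H ψ + I • H ψ⟫_ℂ = 0 :=
    inner_tdvpVelocity_add_eq_zero K H ψ (K.sub_mem hv (tdvpVelocity_mem K H ψ))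
  rw [hsplit, sq, sq, sq]
  exact norm_add_sq_eq_norm_sq_add_norm_sq_of_inner_eq_zero _ _ horth

/-- **The projected velocity minimises the local error** over the tangent space: "The best
approximation is obtained by minimizing `‖Ȧⁱ|∂ᵢψ⟩ + iĤ|ψ⟩‖`.  The minimum is found by orthogonally
projecting". [cite: HaegemanEtAl2011, p. 3] [cite: HacklEtAl2020, §4.1.1 (McLachlan minimal error principle)] -/
theorem norm_tdvpVelocity_add_le {v : E} (hv : v ∈ K) :
    ‖tdvpVelocity K H ψ + I • H ψ‖ ≤ ‖v + I • H ψ‖ := by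
  have h := norm_sq_add_eq K H ψ hv
  nlinarith [norm_nonneg (tdvpVelocity K H ψ + I • H ψ), norm_nonneg (v + I • H ψ),
    sq_nonneg ‖v - tdvpVelocity K H ψ‖]

/-- The minimal local error as an infimum over the tangent space.
[cite: HacklEtAl2020, §4.1.1 (McLachlan)] [cite: HaegemanEtAl2011, p. 3] -/
theorem norm_tdvpVelocity_add_eq_iInf :
    ‖tdvpVelocity K H ψ + I • H ψ‖ = ⨅ v : K, ‖(v : E) + I • H ψ‖ := by
  have h := Submodule.starProjection_minimal (U := K) ((-I) • H ψ)
  have e1 : ∀ w : E, ‖(-I) • H ψ - w‖ = ‖w + I • H ψ‖ := fun w => by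
    rw [← norm_neg]; congr 1; simp [neg_smul]
  rw [tdvpVelocity_def, ← e1, h]
  exact iInf_congr fun v => e1 v

/-- **Uniqueness of the minimiser**: a tangent vector whose local error is at most that of the
projected velocity is the projected velocity. [cite: HacklEtAl2020, §4.1.1] [cite: HaegemanEtAl2011, p. 3] -/
theorem eq_tdvpVelocity_of_norm_le {v : E} (hv : v ∈ K)
    (h : ‖v + I • H ψ‖ ≤ ‖tdvpVelocity K H ψ + I • H ψ‖) : v = tdvpVelocity K H ψ := by
  have hsq := norm_sq_add_eq K H ψ hv
  have h0 : ‖v - tdvpVelocity K H ψ‖ ^ 2 ≤ 0 := by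
    nlinarith [norm_nonneg (tdvpVelocity K H ψ + I • H ψ), norm_nonneg (v + I • H ψ)]
  have h1 : ‖v - tdvpVelocity K H ψ‖ = 0 := by
    nlinarith [norm_nonneg (v - tdvpVelocity K H ψ)]
  exact sub_eq_zero.mp (norm_eq_zero.mp h1)

/-! ### The Gram (normal) equations of Haegeman et al. -/

section Gram

variable {ι : Type*} [Fintype ι] (b : ι → E) (a : ι → ℂ)

/-- **Haegeman et al.'s Eq. (2)**: if the projected velocity is expanded on tangent vectors,
`ψ̇ = Σᵢ aᵢ bᵢ` with all `bᵢ ∈ K`, then the coefficients solve the Gram system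
`Σᵢ ⟨b_j|b_i⟩ aᵢ = −i ⟨b_j|Ĥ|ψ⟩` ("`⟨∂_ȷ̄ψ|∂ᵢψ⟩ Ȧⁱ = −i⟨∂_ȷ̄ψ|Ĥ|ψ⟩` … the LHS contains the Gram
matrix of the tangent vectors"). [cite: HaegemanEtAl2011, Eq. (2)] -/
theorem gram_eq (hb : ∀ i, b i ∈ K) (ha : ∑ i, a i • b i = tdvpVelocity K H ψ) (j : ι) :
    ∑ i, ⟪b j, b i⟫_ℂ * a i = -I * ⟪b j, H ψ⟫_ℂ := by
  rw [← inner_tdvpVelocity_of_mem K H ψ (hb j), ← ha, inner_sum]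
  exact Finset.sum_congr rfl fun i _ => by rw [inner_smul_right, mul_comm]

/-- **Converse**: if the tangent vectors `bᵢ` span `K`, every solution `a` of the Gram system
assembles to the projected velocity, `Σᵢ aᵢ bᵢ = ψ̇` (so the Gram system determines `ψ̇` even when
the Gram matrix is singular — only the combination `Σ aᵢbᵢ` is determined; cf. the pseudo-inverse
remarks of both sources). [cite: HaegemanEtAl2011, Eq. (2)] [cite: HacklEtAl2020, §4.1.1] -/
theorem sum_smul_eq_tdvpVelocity_of_gram (hb : ∀ i, b i ∈ K)
    (hK : K ≤ Submodule.span ℂ (Set.range b))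
    (h : ∀ j, ∑ i, ⟪b j, b i⟫_ℂ * a i = -I * ⟪b j, H ψ⟫_ℂ) :
    ∑ i, a i • b i = tdvpVelocity K H ψ := by
  set w : E := ∑ i, a i • b i with hw
  set r : E := w + I • H ψ with hr
  have hwK : w ∈ K := K.sum_mem fun i _ => K.smul_mem _ (hb i)
  -- every generator is orthogonal to the residual `r`
  have hgen : ∀ j, ⟪b j, r⟫_ℂ = 0 := fun j => by
    have : ⟪b j, w⟫_ℂ = -I * ⟪b j, H ψ⟫_ℂ := by
      rw [← h j, hw, inner_sum]
      exact Finset.sum_congr rfl fun i _ => by rw [inner_smul_right, mul_comm]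
    rw [hr, inner_add_right, this, inner_smul_right]
    ring
  -- hence so is all of `span (range b) ⊇ K`
  have hspan : Submodule.span ℂ (Set.range b) ≤ (ℂ ∙ r)ᗮ := by
    rw [Submodule.span_le]
    rintro _ ⟨j, rfl⟩
    exact (Submodule.mem_orthogonal_singleton_iff_inner_left).mpr (hgen j)
  refine eq_tdvpVelocity_of_forall_inner_eq K H ψ hwK fun v hv => ?_
  have hv0 : ⟪v, r⟫_ℂ = 0 :=
    (Submodule.mem_orthogonal_singleton_iff_inner_left).mp (hspan (hK hv))
  rw [hr, inner_add_right, inner_smul_right] at hv0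
  linear_combination hv0

end Gram

/-! ### Lagrangian = McLachlan = Dirac–Frenkel on a complex tangent space (Hackl et al. Prop. 6) -/

/-- **McLachlan projected Schrödinger equation** `ℙ_ψ((d/dt) + iĤ)|ψ⟩ = 0` holds for the projected
velocity. [cite: HacklEtAl2020, Prop. 6 (proof, "McLachlan: `ℙ_ψ(d/dt + iĤ)|ψ⟩ = 0`")] -/
theorem mcLachlan_projected : K.starProjection (tdvpVelocity K H ψ + I • H ψ) = 0 := by
  rw [map_add, map_smul, tdvpVelocity_eq_smul, map_smul,
    Submodule.starProjection_eq_self_iff.mpr (K.starProjection_apply_mem _)]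
  simp [neg_smul]

/-- **Lagrangian projected Schrödinger equation** `ℙ_ψ(i(d/dt) − Ĥ)|ψ⟩ = 0` ALSO holds for the
projected velocity, because `K` is complex ("if the manifold is Kähler, an imaginary unit can be
factored out … making them coincide"). [cite: HacklEtAl2020, Prop. 6 (proof, "Lagrangian: `ℙ_ψ(i d/dt − Ĥ)|ψ⟩ = 0`")] -/
theorem lagrangian_projected : K.starProjection (I • tdvpVelocity K H ψ - H ψ) = 0 := by
  rw [map_sub, map_smul, tdvpVelocity_eq_smul, map_smul,
    Submodule.starProjection_eq_self_iff.mpr (K.starProjection_apply_mem _), smul_smul]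
  simp

/-! ### Conservation laws at one instant -/

/-- **Norm and phase**: if the tangent space contains the state itself (`ψ ∈ K`; "the tangent plane
contains the state itself, since `Aⁱ|∂ᵢψ(A)⟩ = |ℤ| |ψ(A)⟩`"), then `⟨ψ|ψ̇⟩ = −i⟨ψ|Ĥ|ψ⟩`, which is
purely imaginary for symmetric `Ĥ`: `Re⟨ψ|ψ̇⟩ = 0`, i.e. `d‖ψ‖²/dt = 2 Re⟨ψ|ψ̇⟩ = 0`.
[cite: HaegemanEtAl2011, p. 3] [cite: HacklEtAl2020, §2.2.1–§2.2.2 ("the states remain normalized during the evolution")] -/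
theorem re_inner_self_tdvpVelocity (hH : (H : E →ₗ[ℂ] E).IsSymmetric) (hψ : ψ ∈ K) :
    (⟪ψ, tdvpVelocity K H ψ⟫_ℂ).re = 0 := by
  rw [inner_tdvpVelocity_of_mem K H ψ hψ]
  have hreal : conj ⟪ψ, H ψ⟫_ℂ = ⟪ψ, H ψ⟫_ℂ := by
    rw [inner_conj_symm]; exact hH ψ ψ
  have him : (⟪ψ, H ψ⟫_ℂ).im = 0 := by
    simpa using Complex.conj_eq_iff_im.mp hreal
  simp [Complex.mul_re, him]

/-- **Energy conservation, instantaneous form**: `Re⟨Ĥψ|ψ̇⟩ = 0` for the projected velocity on ANY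
complex tangent space (`⟨Ĥψ|P_K(−iĤψ)⟩ = −i‖P_K Ĥψ‖²` is purely imaginary); with the product rule
`d⟨ψ|Ĥ|ψ⟩/dt = 2 Re⟨Ĥψ|ψ̇⟩` for symmetric `Ĥ` this is "they respect energy conservation".
[cite: HaegemanEtAl2011, p. 3] [cite: HacklEtAl2020, §2.2.2, §4.1.1 ("For a time-independent Hamiltonian, they always preserve the energy expectation value")] -/
theorem re_inner_hamiltonian_tdvpVelocity : (⟪H ψ, tdvpVelocity K H ψ⟫_ℂ).re = 0 := by
  rw [tdvpVelocity_eq_smul, inner_smul_right]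
  have hreal : (⟪H ψ, K.starProjection (H ψ)⟫_ℂ).im = 0 := by
    rw [← Submodule.starProjection_eq_self_iff.mpr (K.starProjection_apply_mem (H ψ)),
      ← Submodule.inner_starProjection_left_eq_right]
    exact inner_self_im (𝕜 := ℂ) _
  simp [Complex.mul_re, hreal]

/-- **Energy conservation, product-rule form**: for symmetric `Ĥ`,
`⟨ψ̇|Ĥψ⟩ + ⟨ψ|Ĥψ̇⟩ = 0` — the two terms of `d⟨ψ(t)|Ĥ|ψ(t)⟩/dt`.
[cite: HacklEtAl2020, §2.2.2] [cite: HaegemanEtAl2011, p. 3] -/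
theorem inner_tdvpVelocity_hamiltonian_add (hH : (H : E →ₗ[ℂ] E).IsSymmetric) :
    ⟪tdvpVelocity K H ψ, H ψ⟫_ℂ + ⟪ψ, H (tdvpVelocity K H ψ)⟫_ℂ = 0 := by
  have h1 : ⟪ψ, H (tdvpVelocity K H ψ)⟫_ℂ = ⟪H ψ, tdvpVelocity K H ψ⟫_ℂ := (hH ψ _).symm
  have h2 : ⟪tdvpVelocity K H ψ, H ψ⟫_ℂ = conj ⟪H ψ, tdvpVelocity K H ψ⟫_ℂ :=
    (inner_conj_symm _ _).symm
  have hre := re_inner_hamiltonian_tdvpVelocity K H ψ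
  rw [h1, h2]
  apply Complex.ext
  · rw [Complex.add_re, Complex.conj_re, hre, Complex.zero_re, add_zero]
  · rw [Complex.add_im, Complex.conj_im, Complex.zero_im]; ring

/-- **Conserved symmetry generators (Hackl et al. Prop. 7), instantaneous form.**  Let `Â` be
symmetric, commute with `Ĥ` on `ψ` (`ÂĤψ = ĤÂψ`), and preserve the manifold in the sense
`(Â − c)ψ ∈ K` for a real number `c` (Hackl et al.'s `ℚ_ψÂ|ψ⟩ = (Â − ⟨Â⟩)|ψ⟩ ∈ 𝒯_ψℳ`, `c = ⟨Â⟩`).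
Then `Re⟨Âψ|ψ̇⟩ = c · Re⟨ψ|ψ̇⟩`: the rate of `⟨ψ|Â|ψ⟩` is `c` times the rate of `⟨ψ|ψ⟩`
("`(d/dt)A(t) = 2Re⟨ψ|(Â − ⟨Â⟩)(−iĤ)|ψ⟩/⟨ψ|ψ⟩ = i⟨ψ|[Ĥ,Â]|ψ⟩/⟨ψ|ψ⟩ = 0`").
[cite: HacklEtAl2020, Prop. 7 (statement and proof)] [cite: HaegemanEtAl2011, p. 3 ("conservation of all constants of motion, such as the expectation value of generators of symmetries")] -/
theorem re_inner_symm_tdvpVelocity (A : E →L[ℂ] E) (hA : (A : E →ₗ[ℂ] E).IsSymmetric)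
    (hH : (H : E →ₗ[ℂ] E).IsSymmetric) (hcomm : A (H ψ) = H (A ψ)) (c : ℝ)
    (hAK : A ψ - (c : ℂ) • ψ ∈ K) :
    (⟪A ψ, tdvpVelocity K H ψ⟫_ℂ).re = c * (⟪ψ, tdvpVelocity K H ψ⟫_ℂ).re := by
  have hsplit : ⟪A ψ, tdvpVelocity K H ψ⟫_ℂ =
      ⟪A ψ - (c : ℂ) • ψ, tdvpVelocity K H ψ⟫_ℂ + (c : ℂ) * ⟪ψ, tdvpVelocity K H ψ⟫_ℂ := by
    rw [inner_sub_left, inner_smul_left, Complex.conj_ofReal]; ring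
  -- the tangential part has purely imaginary matrix element
  have h1 : ⟪A ψ - (c : ℂ) • ψ, tdvpVelocity K H ψ⟫_ℂ =
      -I * (⟪A ψ, H ψ⟫_ℂ - (c : ℂ) * ⟪ψ, H ψ⟫_ℂ) := by
    rw [inner_tdvpVelocity_of_mem K H ψ hAK, inner_sub_left, inner_smul_left, Complex.conj_ofReal]
  have hAH : (⟪A ψ, H ψ⟫_ℂ).im = 0 := by
    have : conj ⟪A ψ, H ψ⟫_ℂ = ⟪A ψ, H ψ⟫_ℂ := by
      rw [inner_conj_symm]
      calc ⟪H ψ, A ψ⟫_ℂ = ⟪ψ, H (A ψ)⟫_ℂ := hH ψ (A ψ)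
        _ = ⟪ψ, A (H ψ)⟫_ℂ := by rw [hcomm]
        _ = ⟪A ψ, H ψ⟫_ℂ := (hA ψ (H ψ)).symm
    simpa using Complex.conj_eq_iff_im.mp this
  have hψH : (⟪ψ, H ψ⟫_ℂ).im = 0 := by
    have : conj ⟪ψ, H ψ⟫_ℂ = ⟪ψ, H ψ⟫_ℂ := by rw [inner_conj_symm]; exact hH ψ ψ
    simpa using Complex.conj_eq_iff_im.mp this
  rw [hsplit, h1]
  simp [Complex.mul_re, Complex.mul_im, hAH, hψH]

/-- **Corollary (tangent space containing the state)**: under the hypotheses of Prop. 7 and `ψ ∈ K`,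
`Re⟨Âψ|ψ̇⟩ = 0`, i.e. `d⟨ψ|Â|ψ⟩/dt = 0`. [cite: HacklEtAl2020, Prop. 7] [cite: HaegemanEtAl2011, p. 3] -/
theorem re_inner_symm_tdvpVelocity_eq_zero (A : E →L[ℂ] E) (hA : (A : E →ₗ[ℂ] E).IsSymmetric)
    (hH : (H : E →ₗ[ℂ] E).IsSymmetric) (hcomm : A (H ψ) = H (A ψ)) (c : ℝ)
    (hAK : A ψ - (c : ℂ) • ψ ∈ K) (hψ : ψ ∈ K) :
    (⟪A ψ, tdvpVelocity K H ψ⟫_ℂ).re = 0 := by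
  rw [re_inner_symm_tdvpVelocity K H ψ A hA hH hcomm c hAK, re_inner_self_tdvpVelocity K H ψ hH hψ,
    mul_zero]

/-- **Corollary (normalised expectation value)**: with `c = ⟨ψ|Â|ψ⟩/⟨ψ|ψ⟩` the quotient-rule
numerator of `d/dt (⟨ψ|Â|ψ⟩/⟨ψ|ψ⟩)`, namely `Re⟨Âψ|ψ̇⟩·‖ψ‖² − Re⟨ψ|Âψ⟩·Re⟨ψ|ψ̇⟩` (up to the
common factor `2`), vanishes — Prop. 7 for the normalised expectation value `A(x)` of Hackl et al.
[cite: HacklEtAl2020, Prop. 7] -/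
theorem expectation_numerator_eq_zero (A : E →L[ℂ] E) (hA : (A : E →ₗ[ℂ] E).IsSymmetric)
    (hH : (H : E →ₗ[ℂ] E).IsSymmetric) (hcomm : A (H ψ) = H (A ψ)) (c : ℝ)
    (hc : c * ‖ψ‖ ^ 2 = (⟪ψ, A ψ⟫_ℂ).re) (hAK : A ψ - (c : ℂ) • ψ ∈ K) :
    (⟪A ψ, tdvpVelocity K H ψ⟫_ℂ).re * ‖ψ‖ ^ 2
      - (⟪ψ, A ψ⟫_ℂ).re * (⟪ψ, tdvpVelocity K H ψ⟫_ℂ).re = 0 := by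
  rw [re_inner_symm_tdvpVelocity K H ψ A hA hH hcomm c hAK, ← hc]
  ring

/-- Sanity check (no approximation): on the full space the projected velocity is the Schrödinger
velocity `−iĤψ`. [cite: HacklEtAl2020, §4.1.1] -/
example : tdvpVelocity (⊤ : Submodule ℂ E) H ψ = (-I) • H ψ := by
  rw [tdvpVelocity_def, Submodule.starProjection_top, ContinuousLinearMap.id_apply]

/-- Sanity check (frozen state): on the zero tangent space nothing moves. [cite: HacklEtAl2020, §4.1.1] -/
example : tdvpVelocity (⊥ : Submodule ℂ E) H ψ = 0 := by
  rw [tdvpVelocity_def, Submodule.starProjection_bot]; rfl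

/-! ### Along a trajectory -/

section Trajectory

variable {K ψ}
variable (Kt : ℝ → Submodule ℂ E) [∀ t, (Kt t).HasOrthogonalProjection] (γ : ℝ → E)

/-- Product rule for a matrix element along a differentiable curve (bounded operator):
`d⟨γ|Âγ⟩/dt = ⟨γ|Âγ̇⟩ + ⟨γ̇|Âγ⟩`. [cite: HacklEtAl2020, §2.2.2 (the computation of `dε/dt`)] -/
theorem hasDerivAt_inner_apply {v : E} {t : ℝ} (hγ : HasDerivAt γ v t) (A : E →L[ℂ] E) :
    HasDerivAt (fun s => ⟪γ s, A (γ s)⟫_ℂ) (⟪γ t, A v⟫_ℂ + ⟪v, A (γ t)⟫_ℂ) t := by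
  have hA : HasDerivAt (fun s => A (γ s)) (A v) t :=
    (A.restrictScalars ℝ).hasFDerivAt.comp_hasDerivAt t hγ
  exact hγ.inner ℂ hA

/-- **Energy is conserved along a TDVP trajectory** (complex tangent spaces `Kt t`, symmetric bounded
`Ĥ`): if `γ̇(t) = P_{K_t}(−iĤγ(t))` for all `t` then `Re⟨γ(t)|Ĥ|γ(t)⟩` has derivative `0` …
[cite: HacklEtAl2020, §2.2.2] [cite: HaegemanEtAl2011, p. 3] -/
theorem hasDerivAt_energy (hH : (H : E →ₗ[ℂ] E).IsSymmetric)
    (hγ : ∀ t, HasDerivAt γ (tdvpVelocity (Kt t) H (γ t)) t) (t : ℝ) :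
    HasDerivAt (fun s => (⟪γ s, H (γ s)⟫_ℂ).re) 0 t := by
  have h := hasDerivAt_inner_apply γ (hγ t) H
  have h2 := Complex.reCLM.hasFDerivAt.comp_hasDerivAt t h
  refine h2.congr_deriv ?_
  change (⟪γ t, H (tdvpVelocity (Kt t) H (γ t))⟫_ℂ + ⟪tdvpVelocity (Kt t) H (γ t), H (γ t)⟫_ℂ).re = 0
  rw [add_comm, inner_tdvpVelocity_hamiltonian_add (Kt t) H (γ t) hH, Complex.zero_re]

/-- … and is therefore constant in time. [cite: HacklEtAl2020, §2.2.2 ("energy expectation value is conserved if the Hamiltonian is time-independent")]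
[cite: HaegemanEtAl2011, p. 3 ("they respect energy conservation")] -/
theorem energy_conserved (hH : (H : E →ₗ[ℂ] E).IsSymmetric)
    (hγ : ∀ t, HasDerivAt γ (tdvpVelocity (Kt t) H (γ t)) t) (s t : ℝ) :
    (⟪γ s, H (γ s)⟫_ℂ).re = (⟪γ t, H (γ t)⟫_ℂ).re :=
  is_const_of_deriv_eq_zero (fun x => (hasDerivAt_energy H Kt γ hH hγ x).differentiableAt)
    (fun x => (hasDerivAt_energy H Kt γ hH hγ x).deriv) s t

/-- **The norm is conserved** when each tangent space contains the state (`γ t ∈ Kt t`):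
`d‖γ‖²/dt = 2Re⟨γ|γ̇⟩ = 0`. [cite: HaegemanEtAl2011, p. 3] [cite: HacklEtAl2020, §2.2.1–§2.2.2] -/
theorem hasDerivAt_norm_sq (hH : (H : E →ₗ[ℂ] E).IsSymmetric)
    (hγ : ∀ t, HasDerivAt γ (tdvpVelocity (Kt t) H (γ t)) t) (hmem : ∀ t, γ t ∈ Kt t) (t : ℝ) :
    HasDerivAt (fun s => ‖γ s‖ ^ 2) 0 t := by
  have h := (hγ t).inner ℂ (hγ t)
  have h2 : HasDerivAt (fun s => (⟪γ s, γ s⟫_ℂ).re)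
      ((⟪γ t, tdvpVelocity (Kt t) H (γ t)⟫_ℂ + ⟪tdvpVelocity (Kt t) H (γ t), γ t⟫_ℂ).re) t :=
    Complex.reCLM.hasFDerivAt.comp_hasDerivAt t h
  have h3 : (fun s => ‖γ s‖ ^ 2) = fun s => (⟪γ s, γ s⟫_ℂ).re := by
    funext s; rw [← inner_self_eq_norm_sq (𝕜 := ℂ)]; rfl
  rw [h3]
  refine h2.congr_deriv ?_
  rw [Complex.add_re, ← inner_conj_symm (tdvpVelocity (Kt t) H (γ t)) (γ t), Complex.conj_re,
    re_inner_self_tdvpVelocity (Kt t) H (γ t) hH (hmem t)]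
  ring

/-- Constancy of the norm along the trajectory. [cite: HaegemanEtAl2011, p. 3] [cite: HacklEtAl2020, §2.2.1] -/
theorem norm_sq_conserved (hH : (H : E →ₗ[ℂ] E).IsSymmetric)
    (hγ : ∀ t, HasDerivAt γ (tdvpVelocity (Kt t) H (γ t)) t) (hmem : ∀ t, γ t ∈ Kt t) (s t : ℝ) :
    ‖γ s‖ ^ 2 = ‖γ t‖ ^ 2 :=
  is_const_of_deriv_eq_zero (f := fun s => ‖γ s‖ ^ 2)
    (fun x => (hasDerivAt_norm_sq H Kt γ hH hγ hmem x).differentiableAt)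
    (fun x => (hasDerivAt_norm_sq H Kt γ hH hγ hmem x).deriv) s t

/-- **Hackl et al. Prop. 7 along a trajectory**: a symmetric `Â` commuting with `Ĥ` along the curve
and preserving the manifold (`(Â − c(t))γ(t) ∈ K_t`, each `K_t` containing `γ(t)`) has constant
expectation value `Re⟨γ(t)|Â|γ(t)⟩`. [cite: HacklEtAl2020, Prop. 7] [cite: HaegemanEtAl2011, p. 3] -/
theorem expectation_conserved (hH : (H : E →ₗ[ℂ] E).IsSymmetric) (A : E →L[ℂ] E)
    (hA : (A : E →ₗ[ℂ] E).IsSymmetric) (hcomm : ∀ t, A (H (γ t)) = H (A (γ t))) (c : ℝ → ℝ)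
    (hAK : ∀ t, A (γ t) - (c t : ℂ) • γ t ∈ Kt t)
    (hγ : ∀ t, HasDerivAt γ (tdvpVelocity (Kt t) H (γ t)) t) (hmem : ∀ t, γ t ∈ Kt t) (s t : ℝ) :
    (⟪γ s, A (γ s)⟫_ℂ).re = (⟪γ t, A (γ t)⟫_ℂ).re := by
  have hd : ∀ x, HasDerivAt (fun s => (⟪γ s, A (γ s)⟫_ℂ).re) 0 x := fun x => by
    have h := hasDerivAt_inner_apply γ (hγ x) A
    have h2 := Complex.reCLM.hasFDerivAt.comp_hasDerivAt x h
    refine h2.congr_deriv ?_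
    change (⟪γ x, A (tdvpVelocity (Kt x) H (γ x))⟫_ℂ
      + ⟪tdvpVelocity (Kt x) H (γ x), A (γ x)⟫_ℂ).re = 0
    have e1 : ⟪γ x, A (tdvpVelocity (Kt x) H (γ x))⟫_ℂ = ⟪A (γ x), tdvpVelocity (Kt x) H (γ x)⟫_ℂ :=
      (hA (γ x) _).symm
    have e2 : ⟪tdvpVelocity (Kt x) H (γ x), A (γ x)⟫_ℂ
        = conj ⟪A (γ x), tdvpVelocity (Kt x) H (γ x)⟫_ℂ := (inner_conj_symm _ _).symm
    rw [e1, e2, Complex.add_re, Complex.conj_re,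
      re_inner_symm_tdvpVelocity_eq_zero (Kt x) H (γ x) A hA hH (hcomm x) (c x) (hAK x) (hmem x)]
    ring
  exact is_const_of_deriv_eq_zero (fun x => (hd x).differentiableAt) (fun x => (hd x).deriv) s t

end Trajectory

end Literature.MathematicalPhysics.QuantumManyBody.TimeDependentVariationalPrinciple
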